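import Summits.ABC.IUTFork.Charitable.Thm311D1D2Concordance
import Summits.ABC.IUTFork.Charitable.Thm311D3DeriveIff
import Summits.ABC.IUTFork.Charitable.Thm311D4Derive
import Summits.ABC.IUTFork.Charitable.Thm311D4Checks
import HarnessLib

/-!
# Branch D — FOUR BLIND CHARITABLE RE-TYPINGS OF [IUTchIII] Thm. 3.11, ONE SENTENCE: the kernel concordance D1 · D2 · D3 · D4

Proof-only file (D-0012; abc-iut cell, rung LADDER-ABC:A2.D; written by abc-iut-D1-typ (team D1's typer/anchor) as the batch-2/3
sequel of `Charitable/Thm311D1D2Concordance.lean` (p429595)). NO definition, NO `Prop` fact; every typing is consumed BY NAME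
(DEFS-FREEZE): team D1 `Charitable/Thm311D1.lean` (p428378/p429129), team D2 `Charitable/Thm311D2.lean` (p428473/p429714), team D3
`Charitable/Thm311D3.lean` (p431029) with `Thm311D3Derive` (p431653), team D4 `Charitable/Thm311D4.lean` (p433089) with
`Thm311D4Derive` (p433392) and `Thm311D4Checks` (p433449). The four teams re-typed S. Mochizuki, *Inter-universal Teichmüller
theory III* (kurims, May 2020), Theorem 3.11 (i)–(iii) pp. 153–159 with Remark 3.11.1 pp. 159–167, pairwise BLIND (D1 ∥ D2, then
D3 and D4 blind to everybody), each «in the strongest reading the print can bear», and each team DERIVED the cell's residual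
`S := Cor312Vol.PilotKummerIndRelated` (Cor312PinnedRegionsThreePins.lean:145) from its typing (D1 p428642, D2 p428699, D3 p431653,
D4 p433392). TAKES NO SIDE on [IUTchIII] Cor. 3.12 or on any author; asserts nothing about print; typed ≠ proved.
[claim: Mochizuki2012, status: disputed]

WHAT IS PROVED (kernel). Write `E(n, q) := ∃ D′ ∈ ⁿ’°ℜ^LGP, q = Ψ(D′)` («the q-datum IS the splitting-monoid datum of a possibility
of line n», the étale-orbit form) and `F(n, q) := ∃ Φ ∈ ⟨(Ind1)∪(Ind2)⟩, ∃ m′, q = Φ · Ψ^{Frob}_{(n−1,m′)}` («the q-datum IS one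
indeterminacy-translate of a Frobenius-like Θ-Kummer image of the previous column», the square form) — in the tree these are,
respectively, `D2.Rmk3111_iii_IPL S n q` / `D1.PartIII.linkKummer S q (n−1)` and `D2.III_c_KummerLinkSquare S n q`; abc-iut-w5-d068's
clause of record `Cor312Vol.PilotKummerCompat S P q` is `F` read at the setting's own column.
* §2 — the four load-bearing clauses are LITERALLY these two shapes: D4's decisive clause (L) `D4.LinkKummerCompat S Q` is
  `∀ n m, F(n, Q.qΨ n m)` by `Iff.rfl` (`d4_linkKummerCompat_iff_squares`); D3's (iii)(c)-final clause `D3.EvalLinkCompat S X` is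
  `∀ n m, F(n+1, X.qKum (n+1) m)` (`d3_evalLinkCompat_iff_squares`) and — for ANY choice of D4's automorphism-set fields — IS D4's
  clause on the data `⟨X.qKum, _, _⟩` (`d3_evalLinkCompat_iff_d4_linkKummerCompat`); D3's maximal (IPL) clause is, under its own
  (SHE)/`AlgOutput`, `∀ n m, E(n, X.qKum n m)` plus a Θ-half that is a THEOREM of the frozen (ii)(b) (`d3_ipl_iff`,
  `ipl_theta_of_kummerB`); D1's L2 is `E(n+1, qK)` and D2's III-c-2 is `F(n, qK)` (p429595).
* §2 (cont.) — `E` and `F` are ONE predicate under the frozen (i) `MultiradialCompat` and (ii)(b) `KummerB` (`exists_iff_square`,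
  routed through team D1's `linkKummer_iff_kummerLinkSquare`), at every pair of line indices.
* §3/§4 — AT THE PINS' BINDER `qK` (column `P.n`), every team's typing yields EVERY other team's load-bearing clause and the clause of
  record: `Thm311Charitable_3 ⊢ D1-L2 ∧ D2-square ∧ PilotKummerCompat` (`d3_linkKummer`, `d3_square`, `d3_pilotKummerCompat`);
  `Thm311Charitable_4 ⊢` the same for `qK := Q.qΨ P.n m` (`d4_linkKummer`, `d4_square`; PKC is abc-iut-D4-prv's
  `D4Derive.pilotKummerCompat_of_charitable_4`); conversely the frozen (i) ∧ (ii) ∧ `PilotKummerCompat S P qK` (∧ the hull conjunct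
  D3 carries) REBUILD team D3's existential typing (`charitable_3_of_pilotKummerCompat` = abc-iut-D3-prv's own X-elimination
  `D3DeriveIff.thm311Charitable_3_iff`, p434033, consumed BY NAME) and team D4's (`charitable_4_of_pilotKummerCompat`, data `⟨qK, {1}, {1}⟩`).
* §5 — EXACTNESS (D3's is p434033): `(∃ Q, (∃ m, Q.qΨ P.n m = qK) ∧ Thm311Charitable_4 S Q) ⟺ S.PartI ∧ S.PartII ∧ PilotKummerCompat S P qK`
  (`charitable_4_iff`); `D1.Thm311Charitable_1 S P qK ⟺ D1.PartI S ∧ D1.PartII S ∧ PilotKummerCompat S P qK ∧ D1.PartIII.hull S P`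
  (`charitable_1_iff`).
* §6 — `four_typings_one_sentence`: the package for the referees' §L — all four (a)-theorems factor through `PilotKummerCompat`,
  which gives S under (ii)(b) for column `P.n` (abc-iut-w5-d068 `pilotKummerIndRelated_of_pilotKummerCompat`), pins idle.
So the branch question «is G an artefact of an uncharitable typing?» receives ONE kernel answer from four blind teams: each priced
S at the SAME sentence — the datum-level reading of (iii)(c)'s final clause (p. 158 l. 5–15) / (IPL) (p. 160 l. 30–45) — whose
faithfulness to print the D referees grade, NOT this file (grades of record at the time of writing attach to how each typing
HANGS the sentence on print, not to its kernel content: D-ref / D-ref-2 — D1, D2 STRONGER-THAN-PRINT at exactly this clause;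
D-ref-3 09:24:16Z — D1, D4 FAITHFUL-AT-CEILING (Remark-homed, theorem-sentence conceded), D2, D3 STRONGER-THAN-PRINT (sentence-homed);
the referees' fold decides). Framing: locates / conditionally verifies; no abc claim; no side on any author; typed ≠ proved.
-/

noncomputable section

open Set

namespace Summit.ABC.IUTFork.Charitable

open Thm311 Cor312 Cor312Vol Literature.IUT.LogThetaLattice

namespace DConcordance

variable {T : ThetaIndex} (S : LatticeSituation T) (P : Cor312.Setting S.toSituation)
  (ρ : (∀ v : T.V, v ∈ T.Vbad → Set (S.L.StarPacket v)) → ∀ (j : T.Label) (vQ : T.VQ), Set (S.L.Packet j vQ))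
  (qK : ∀ v : T.V, v ∈ T.Vbad → Set (S.L.StarPacket v))

/-! ## 1. Teams D3/D4 cite the FROZEN (i)/(ii) (abc-iut-c312-1); these contain teams D1/D2's shared clauses -/

/-- The frozen Thm. 3.11 (i) (`Situation.PartI`, whose third conjunct is `MultiradialCompat`) gives team D1's permutation-symmetry
clause (= team D2's `I_PermSymmetric`, p429595 `perm_iff_permSymmetric`). [claim: Mochizuki2012, status: disputed] -/
theorem perm_of_frozen_partI (h : S.PartI) : D1.PartI.perm S :=
  (D1.perm_iff_multiradialCompat S).2 h.2.2

/-- The frozen Thm. 3.11 (ii) (`LatticeSituation.PartII`, (b) = `KummerB` at every column) gives team D1's (ii)(b) splitting clause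
(= team D2's `II_b_SplittingKummer`). [claim: Mochizuki2012, status: disputed] -/
theorem splitting_of_frozen_partII (h : S.PartII) : D1.PartII.splitting S :=
  fun n m v hv => (h n).2.1 m v hv

/-! ## 2. The two formula shapes, and the four load-bearing clauses as instances of them -/

/-- Shape `E`: team D2's strong (IPL) gloss `Rmk3111_iii_IPL S n q` is, up to `funext`, «`q = Ψ(D′)` for a possibility `D′ ∈ ⁿ’°ℜ^LGP`».
[claim: Mochizuki2012, status: disputed] -/
theorem ipl_iff_exists (n : ℤ) (q : ∀ v : T.V, v ∈ T.Vbad → Set (S.L.StarPacket v)) :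
    D2.Rmk3111_iii_IPL S n q ↔ ∃ D' ∈ S.RLGP n, q = D'.Ψ :=
  ⟨fun ⟨D', hD', h⟩ => ⟨D', hD', funext fun v => funext fun hv => h v hv⟩,
    fun ⟨D', hD', h⟩ => ⟨D', hD', fun v hv => by rw [h]⟩⟩

/-- Team D1's L2 `PartIII.linkKummer S q n` is shape `E` at line `n+1` (= D2's (IPL) gloss there), for EVERY `n` (p429595 had `n = P.n`
under the permutation symmetry). [claim: Mochizuki2012, status: disputed] -/
theorem linkKummer_iff_ipl_succ (n : ℤ) (q : ∀ v : T.V, v ∈ T.Vbad → Set (S.L.StarPacket v)) :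
    D1.PartIII.linkKummer S q n ↔ D2.Rmk3111_iii_IPL S (n + 1) q :=
  (ipl_iff_exists S (n + 1) q).symm

/-- `E` and `F` are ONE predicate under the frozen (i) `MultiradialCompat` and (ii)(b) at every column, at EVERY pair of line indices
(routed through team D1's `linkKummer_iff_of_perm` and p429595's `linkKummer_iff_kummerLinkSquare`). [claim: Mochizuki2012, status: disputed] -/
theorem exists_iff_square (hMR : S.MultiradialCompat) (hB : ∀ n : ℤ, (S.col n).KummerB (S.D n)) (n n' : ℤ)
    (q : ∀ v : T.V, v ∈ T.Vbad → Set (S.L.StarPacket v)) :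
    (∃ D' ∈ S.RLGP n, q = D'.Ψ) ↔ D2.III_c_KummerLinkSquare S n' q := by
  have hperm : D1.PartI.perm S := (D1.perm_iff_multiradialCompat S).2 hMR
  rw [← D1.linkKummer_iff_of_perm S q hperm 0 n]
  exact linkKummer_iff_kummerLinkSquare S q hperm hB 0 n'

/-- **Team D4's decisive clause (L) is LITERALLY a family of team D2's squares**: `D4.LinkKummerCompat S Q` ⟺ `∀ n m, F(n, Q.qΨ n m)`,
by `Iff.rfl` — two blind seats typed p. 158 l. 5–15 as the same formula (D2 for the one binder `qK`, D4 for its field `qΨ n m`).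
[claim: Mochizuki2012, status: disputed] -/
theorem d4_linkKummerCompat_iff_squares (Q : D4.LinkKummerData S) :
    D4.LinkKummerCompat S Q ↔ ∀ n m : ℤ, D2.III_c_KummerLinkSquare S n (Q.qΨ n m) :=
  Iff.rfl

/-- Team D4's (L) as a family of team D1's L2 clauses (any line), under the frozen (i) and (ii)(b) (abc-iut-D4-typ's own
`D4.linkKummerCompat_iff_mem_possibleImages` is the `E`-form). [claim: Mochizuki2012, status: disputed] -/
theorem d4_linkKummerCompat_iff_linkKummer (Q : D4.LinkKummerData S) (hMR : S.MultiradialCompat)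
    (hB : ∀ n : ℤ, (S.col n).KummerB (S.D n)) :
    D4.LinkKummerCompat S Q ↔ ∀ n m k : ℤ, D1.PartIII.linkKummer S (Q.qΨ n m) k := by
  rw [D4.linkKummerCompat_iff_mem_possibleImages hMR hB]
  have hperm : D1.PartI.perm S := (D1.perm_iff_multiradialCompat S).2 hMR
  exact ⟨fun h n m k => (D1.linkKummer_iff_of_perm S _ hperm k n).2 (h n m),
    fun h n m => (D1.linkKummer_iff_of_perm S _ hperm n n).1 (h n m n)⟩

/-- **Team D3's (iii)(c)-final clause is a family of team D2's squares**: `D3.EvalLinkCompat S X` ⟺ `∀ n m, F(n+1, X.qKum (n+1) m)`.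
[claim: Mochizuki2012, status: disputed] -/
theorem d3_evalLinkCompat_iff_squares (X : D3.Data S) :
    D3.EvalLinkCompat S X ↔ ∀ n m : ℤ, D2.III_c_KummerLinkSquare S (n + 1) (X.qKum (n + 1) m) := by
  unfold D3.EvalLinkCompat D2.III_c_KummerLinkSquare
  simp only [add_sub_cancel_right]

/-- **Teams D3 and D4 typed the SAME decisive formula**, up to the line shift `n ↦ n+1` (D3 indexes the arrow by its domain column, D4
by its codomain line): for ANY choice of D4's automorphism-set fields, D3's `EvalLinkCompat` on `X` IS D4's `LinkKummerCompat` on the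
link/Kummer data whose q-field is `X.qKum`. [claim: Mochizuki2012, status: disputed] -/
theorem d3_evalLinkCompat_iff_d4_linkKummerCompat (X : D3.Data S) (linkΦ stripΦ : ℤ → ℤ → Set S.L.PacketAut) :
    D3.EvalLinkCompat S X ↔ D4.LinkKummerCompat S ⟨X.qKum, linkΦ, stripΦ⟩ := by
  constructor
  · intro h n m
    obtain ⟨Φ, hΦ, m', hm'⟩ := h (n - 1) m
    refine ⟨Φ, hΦ, m', fun v hv => ?_⟩
    have h1 := hm' v hv
    rw [sub_add_cancel] at h1
    exact h1
  · intro h n m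
    obtain ⟨Φ, hΦ, m', hm'⟩ := h (n + 1) m
    refine ⟨Φ, hΦ, m', fun v hv => ?_⟩
    have h1 := hm' v hv
    rw [add_sub_cancel_right] at h1
    exact h1

/-- The Θ-half of team D3's (IPL) clause is a THEOREM of the frozen (ii)(b): the Frobenius-like Θ-Kummer image of `(n, m)` IS the
splitting-monoid datum of the possibility `S.D n ∈ ⁿ’°ℜ^LGP` itself. [claim: Mochizuki2012, status: disputed] -/
theorem ipl_theta_of_kummerB (hB : ∀ n : ℤ, (S.col n).KummerB (S.D n)) (n m : ℤ) :
    D2.Rmk3111_iii_IPL S n ((S.col n).frobΨ m) :=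
  ⟨S.D n, (S.D n).mem_RLGP_self, fun v hv => hB n m v hv⟩

/-- **Team D3's maximal (IPL) clause, under its own (SHE) and `AlgOutput`, is a family of `E`-shapes** (D2's (IPL) gloss) on the
q-data `X.qKum n m`, plus the Θ-half `ipl_theta_of_kummerB` discharges. [claim: Mochizuki2012, status: disputed] -/
theorem d3_ipl_iff (X : D3.Data S) (hS : D3.SHE S X) (hA : D3.AlgOutput S X) :
    D3.IPL S X ↔ (∀ n m : ℤ, D2.Rmk3111_iii_IPL S n (X.qKum n m)) ∧
      ∀ n m : ℤ, D2.Rmk3111_iii_IPL S n ((S.col n).frobΨ m) := by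
  constructor
  · intro h
    refine ⟨fun n m => ?_, fun n m => ?_⟩
    · obtain ⟨D', hD', hq⟩ := (h n m).1
      rw [hS n m] at hD'
      exact ⟨D', hD', hq⟩
    · obtain ⟨D', hD', hq⟩ := (h n m).2
      rw [hA n m] at hD'
      exact ⟨D', hD', hq⟩
  · rintro ⟨hq, hθ⟩ n m
    obtain ⟨D', hD', h'⟩ := hq n m
    obtain ⟨D'', hD'', h''⟩ := hθ n m
    rw [← hS n m] at hD'
    rw [← hA n m] at hD''
    exact ⟨⟨D', hD', h'⟩, ⟨D'', hD'', h''⟩⟩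

/-- Hence, under (SHE), `AlgOutput` and the frozen (i)/(ii)(b), team D3's TWO load-bearing clauses (abc-iut-D3-cx's isolation p432359:
`IPL` / `EvalLinkCompat`) are ONE clause in two indexings: the q-half of (IPL) ⟺ `EvalLinkCompat`. [claim: Mochizuki2012, status: disputed] -/
theorem d3_ipl_iff_evalLinkCompat (X : D3.Data S) (hS : D3.SHE S X) (hA : D3.AlgOutput S X) (hMR : S.MultiradialCompat)
    (hB : ∀ n : ℤ, (S.col n).KummerB (S.D n)) : D3.IPL S X ↔ D3.EvalLinkCompat S X := by
  rw [d3_ipl_iff S X hS hA, d3_evalLinkCompat_iff_d4_linkKummerCompat S X (fun _ _ => {1}) (fun _ _ => {1}),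
    D4.linkKummerCompat_iff_mem_possibleImages hMR hB]
  constructor
  · rintro ⟨h, -⟩ n m
    exact (ipl_iff_exists S n _).1 (h n m)
  · intro h
    exact ⟨fun n m => (ipl_iff_exists S n _).2 (h n m), ipl_theta_of_kummerB S hB⟩

/-! ## 3. At the pins' binder: team D3's typing yields everybody's load-bearing clause, and conversely -/

/-- `Thm311Charitable_3 ⊢` team D1's L2 at EVERY line (through abc-iut-D3-typ's unfolding `D3.ipl_at_pilot` and the frozen (i)).
[claim: Mochizuki2012, status: disputed] -/
theorem d3_linkKummer (h : Thm311Charitable_3 S P ρ qK) (k : ℤ) : D1.PartIII.linkKummer S qK k := by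
  obtain ⟨X, hX⟩ := h
  obtain ⟨D', hD', hq⟩ := D3.ipl_at_pilot S P X qK hX.ipl hX.she hX.qDatum
  exact (D1.linkKummer_iff_of_perm S qK (perm_of_frozen_partI S hX.partI) k P.n).2
    ⟨D', hD', funext fun v => funext fun hv => hq v hv⟩

/-- `Thm311Charitable_3 ⊢` team D2's square at line `P.n` — VERBATIM abc-iut-D3-typ's unfolding `D3.evalLinkCompat_at_pilot` (two blind
seats, one formula). [claim: Mochizuki2012, status: disputed] -/
theorem d3_square (h : Thm311Charitable_3 S P ρ qK) : D2.III_c_KummerLinkSquare S P.n qK := by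
  obtain ⟨X, hX⟩ := h
  exact D3.evalLinkCompat_at_pilot S P X qK hX.evalLinkCompat hX.qDatum

/-- `Thm311Charitable_3 ⊢` the clause of record `PilotKummerCompat` (route via (IPL) → D1-L2 → p429595). [claim: Mochizuki2012, status: disputed] -/
theorem d3_pilotKummerCompat (h : Thm311Charitable_3 S P ρ qK) : PilotKummerCompat S P qK := by
  obtain ⟨X, hX⟩ := h
  exact (linkKummer_iff_pilotKummerCompat S P qK (perm_of_frozen_partI S hX.partI) (splitting_of_frozen_partII S hX.partII)).1
    (d3_linkKummer S P ρ qK ⟨X, hX⟩ P.n)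

/-- … and a second, independent route to the same: via the (iii)(c) square and abc-iut-D2-prv's `D2.pilotKummerCompat_of_square`.
[claim: Mochizuki2012, status: disputed] -/
theorem d3_pilotKummerCompat' (h : Thm311Charitable_3 S P ρ qK) : PilotKummerCompat S P qK := by
  obtain ⟨X, hX⟩ := h
  exact D2.pilotKummerCompat_of_square S P qK (perm_of_frozen_partI S hX.partI) (splitting_of_frozen_partII S hX.partII)
    (d3_square S P ρ qK ⟨X, hX⟩)

/-- `Thm311Charitable_3 ⊢` the hull conjunct it carries (through abc-iut-D3-prv's `D3DeriveIff.thm311Charitable_3_iff`).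
[claim: Mochizuki2012, status: disputed] -/
theorem d3_hull (h : Thm311Charitable_3 S P ρ qK) : PilotKummerCompatHull S P ρ qK :=
  ((D3DeriveIff.thm311Charitable_3_iff S P ρ qK).1 h).2.2.1

/-- **CONVERSE — the clause of record REBUILDS team D3's existential typing**: under the frozen (i) ∧ (ii), `PilotKummerCompat S P qK`
and the hull conjunct D3 carries as an independent clause, charitable data `X : D3.Data S` satisfying all fourteen maximal clauses EXIST
— this is abc-iut-D3-prv's own X-elimination `D3DeriveIff.thm311Charitable_3_iff` (p434033: `Thm311Charitable_3 ⟺ S.PartI ∧ S.PartII ∧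
PilotKummerCompatHull ∧ PilotKummerCompat`), consumed BY NAME. [claim: Mochizuki2012, status: disputed] -/
theorem charitable_3_of_pilotKummerCompat (h1 : S.PartI) (h2 : S.PartII) (hc : PilotKummerCompat S P qK)
    (hH : PilotKummerCompatHull S P ρ qK) : Thm311Charitable_3 S P ρ qK :=
  (D3DeriveIff.thm311Charitable_3_iff S P ρ qK).2 ⟨h1, h2, hH, hc⟩

/-! ## 4. At the pins' binder: team D4's typing yields everybody's load-bearing clause, and conversely -/

/-- `Thm311Charitable_4 ⊢` team D2's square on EVERY q-field `Q.qΨ n m` (abc-iut-D4-typ's `D4.linkKummerCompat_of_charitable`, restated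
in D2's name). [claim: Mochizuki2012, status: disputed] -/
theorem d4_square (Q : D4.LinkKummerData S) (h : Thm311Charitable_4 S Q) (n m : ℤ) :
    D2.III_c_KummerLinkSquare S n (Q.qΨ n m) :=
  D4.linkKummerCompat_of_charitable h n m

/-- `Thm311Charitable_4 ⊢` team D1's L2 on every q-field, at every line (abc-iut-D4-typ's `D4.exists_mem_RLGP_qΨ_eq_of_charitable` is the
`E`-form at the field's own line). [claim: Mochizuki2012, status: disputed] -/
theorem d4_linkKummer (Q : D4.LinkKummerData S) (h : Thm311Charitable_4 S Q) (n m k : ℤ) :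
    D1.PartIII.linkKummer S (Q.qΨ n m) k :=
  (D1.linkKummer_iff_of_perm S _ (perm_of_frozen_partI S h.1) k n).2 (D4.exists_mem_RLGP_qΨ_eq_of_charitable h n m)

/-- `Thm311Charitable_4 ⊢` the clause of record at the pins' column for every vertical coordinate — abc-iut-D4-prv's
`D4Derive.pilotKummerCompat_of_charitable_4`, re-exported for the table. [claim: Mochizuki2012, status: disputed] -/
theorem d4_pilotKummerCompat (Q : D4.LinkKummerData S) (h : Thm311Charitable_4 S Q) (m : ℤ) :
    PilotKummerCompat S P (Q.qΨ P.n m) :=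
  D4Derive.pilotKummerCompat_of_charitable_4 S Q P m h

/-- **CONVERSE — a family of squares IS a D4 datum**: under the frozen (i) ∧ (ii), any vertically constant family `q n m` satisfying
team D2's square at every line makes `⟨q, {1}, {1}⟩` satisfy team D4's whole charitable typing (the automorphism-set clauses hold at
the identity; (iii)(d) is abc-iut-D4-typ's theorem `D4.nfLinkCompat_of_partI_partII`). [claim: Mochizuki2012, status: disputed] -/
theorem charitable_4_of_squares (h1 : S.PartI) (h2 : S.PartII)
    (q : ℤ → ℤ → ∀ v : T.V, v ∈ T.Vbad → Set (S.L.StarPacket v)) (hcoric : ∀ n m m' : ℤ, q n m = q n m')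
    (hsq : ∀ n m : ℤ, D2.III_c_KummerLinkSquare S n (q n m)) :
    Thm311Charitable_4 S ⟨q, fun _ _ => {1}, fun _ _ => {1}⟩ :=
  ⟨h1, h2, fun n m m' v hv => congrFun (congrFun (hcoric n m m') v) hv,
    ⟨fun _ _ => ⟨Set.singleton_nonempty _, Set.singleton_subset_iff.2 (one_mem _)⟩,
      fun _ _ => Set.singleton_subset_iff.2 (one_mem _), D4.nfLinkCompat_of_partI_partII h1 h2⟩,
    fun n m => hsq n m⟩

/-- **CONVERSE at the pins' binder**: the frozen (i) ∧ (ii) ∧ `PilotKummerCompat S P qK` make the CONSTANT link/Kummer data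
`⟨qK, {1}, {1}⟩` satisfy team D4's typing. [claim: Mochizuki2012, status: disputed] -/
theorem charitable_4_of_pilotKummerCompat (h1 : S.PartI) (h2 : S.PartII) (hc : PilotKummerCompat S P qK) :
    Thm311Charitable_4 S ⟨fun _ _ => qK, fun _ _ => {1}, fun _ _ => {1}⟩ :=
  have hperm : D1.PartI.perm S := perm_of_frozen_partI S h1
  have hspl : D1.PartII.splitting S := splitting_of_frozen_partII S h2
  have hL : D1.PartIII.linkKummer S qK P.n := (linkKummer_iff_pilotKummerCompat S P qK hperm hspl).2 hc
  charitable_4_of_squares S h1 h2 (fun _ _ => qK) (fun _ _ _ => rfl) fun n _ =>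
    (linkKummer_iff_kummerLinkSquare S qK hperm hspl P.n n).1 hL

/-- Teams D3 and D4 rebuild EACH OTHER at the pins' binder (through the clause of record): D4's typing with q-field `Q.qΨ P.n m` plus
the hull conjunct gives D3's typing of that datum, and D3's typing gives D4's on the constant data. [claim: Mochizuki2012, status: disputed] -/
theorem charitable_3_of_charitable_4 (Q : D4.LinkKummerData S) (h : Thm311Charitable_4 S Q) (m : ℤ)
    (hH : PilotKummerCompatHull S P ρ (Q.qΨ P.n m)) : Thm311Charitable_3 S P ρ (Q.qΨ P.n m) :=
  charitable_3_of_pilotKummerCompat S P ρ _ h.1 h.2.1 (d4_pilotKummerCompat S P Q h m) hH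

/-- (continued) [claim: Mochizuki2012, status: disputed] -/
theorem charitable_4_of_charitable_3 (h : Thm311Charitable_3 S P ρ qK) :
    Thm311Charitable_4 S ⟨fun _ _ => qK, fun _ _ => {1}, fun _ _ => {1}⟩ := by
  obtain ⟨X, hX⟩ := h
  exact charitable_4_of_pilotKummerCompat S P qK hX.partI hX.partII (d3_pilotKummerCompat S P ρ qK ⟨X, hX⟩)

/-! ## 5. EXACTNESS: what each typing says at the pins' binder, in the frozen vocabulary (team D3's: abc-iut-D3-prv p434033) -/

/-- **Team D4's typing AT THE PINS' BINDER, link/Kummer data ELIMINATED**: some D4 datum whose q-field at the pins' column takes the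
value `qK` satisfies `Thm311Charitable_4` ⟺ frozen (i) ∧ frozen (ii) ∧ `PilotKummerCompat S P qK`. [claim: Mochizuki2012, status: disputed] -/
theorem charitable_4_iff :
    (∃ Q : D4.LinkKummerData S, (∃ m : ℤ, Q.qΨ P.n m = qK) ∧ Thm311Charitable_4 S Q) ↔
      S.PartI ∧ S.PartII ∧ PilotKummerCompat S P qK := by
  constructor
  · rintro ⟨Q, ⟨m, hm⟩, h⟩
    exact ⟨h.1, h.2.1, hm ▸ d4_pilotKummerCompat S P Q h m⟩
  · rintro ⟨h1, h2, hc⟩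
    exact ⟨⟨fun _ _ => qK, fun _ _ => {1}, fun _ _ => {1}⟩, ⟨0, rfl⟩, charitable_4_of_pilotKummerCompat S P qK h1 h2 hc⟩

/-- **Team D1's official typing, unfolded to the sentence**: `D1.Thm311Charitable_1 S P qK` ⟺ D1's Part (i) ∧ Part (ii) ∧
`PilotKummerCompat S P qK` ∧ D1's hull conjunct L1 ((iii)(d) at carrier level is D1's theorem `numberFieldLink_holds`).
[claim: Mochizuki2012, status: disputed] -/
theorem charitable_1_iff :
    D1.Thm311Charitable_1 S P qK ↔ D1.PartI S ∧ D1.PartII S ∧ PilotKummerCompat S P qK ∧ D1.PartIII.hull S P := by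
  constructor
  · intro h
    exact ⟨h.1, h.2.1, (linkKummer_iff_pilotKummerCompat S P qK h.1.1 h.2.1.2.1).1 h.2.2.1, h.2.2.2.1⟩
  · rintro ⟨h1, h2, hc, hH⟩
    exact ⟨h1, h2, (linkKummer_iff_pilotKummerCompat S P qK h1.1 h2.2.1).2 hc, hH, D1.numberFieldLink_holds S⟩

/-! ## 6. The package for §L: four blind typings, one sentence, one residual -/

/-- **FOUR BLIND TYPINGS, ONE SENTENCE.** Each of the four maximally-charitable re-typings of [IUTchIII] Thm. 3.11 yields abc-iut-w5-d068's
datum-level clause of record `PilotKummerCompat` at the pins' binder (D1 p428378, D2 p428473 — via p429595; D3 p431029; D4 p433089 with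
`qK := Q.qΨ P.n m`), and that ONE sentence gives the residual `S = PilotKummerIndRelated` for EVERY region operator `ρ` under (ii)(b)
for column `P.n` — pins idle, as in all four teams' (a)-theorems. [claim: Mochizuki2012, status: disputed] -/
theorem four_typings_one_sentence :
    (D1.Thm311Charitable_1 S P qK → PilotKummerCompat S P qK) ∧
      (D2.Thm311Charitable_2 S P.n qK → PilotKummerCompat S P qK) ∧
      (Thm311Charitable_3 S P ρ qK → PilotKummerCompat S P qK) ∧
      (∀ Q : D4.LinkKummerData S, Thm311Charitable_4 S Q → ∀ m : ℤ, PilotKummerCompat S P (Q.qΨ P.n m)) ∧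
      ((S.col P.n).KummerB (S.D P.n) → PilotKummerCompat S P qK → PilotKummerIndRelated S P ρ qK) :=
  ⟨(both_factor_through_pilotKummerCompat S P ρ qK).1, (both_factor_through_pilotKummerCompat S P ρ qK).2.1,
    d3_pilotKummerCompat S P ρ qK, fun Q h m => d4_pilotKummerCompat S P Q h m,
    fun hB hc => pilotKummerIndRelated_of_pilotKummerCompat S P ρ qK hB hc⟩

/-- **… AND BACK**: under the frozen (i) ∧ (ii), the one sentence returns EVERY team's load-bearing clause / typing at the pins' binder
(D1's L2, D2's square, D3's whole existential typing given its hull conjunct, D4's whole typing on the constant data). So, modulo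
clauses that are theorems of the frozen carrier (and D3's independent hull conjunct), the four blind typings are pairwise EQUIVALENT at
`qK` — they priced S at the same sentence. [claim: Mochizuki2012, status: disputed] -/
theorem one_sentence_four_typings (h1 : S.PartI) (h2 : S.PartII) (hc : PilotKummerCompat S P qK) :
    D1.PartIII.linkKummer S qK P.n ∧ D2.III_c_KummerLinkSquare S P.n qK ∧
      (PilotKummerCompatHull S P ρ qK → Thm311Charitable_3 S P ρ qK) ∧
      Thm311Charitable_4 S ⟨fun _ _ => qK, fun _ _ => {1}, fun _ _ => {1}⟩ :=
  have hperm : D1.PartI.perm S := perm_of_frozen_partI S h1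
  have hspl : D1.PartII.splitting S := splitting_of_frozen_partII S h2
  ⟨(linkKummer_iff_pilotKummerCompat S P qK hperm hspl).2 hc,
    (D2.square_iff_pilotKummerCompat S P qK hperm hspl).2 hc,
    charitable_3_of_pilotKummerCompat S P ρ qK h1 h2 hc,
    charitable_4_of_pilotKummerCompat S P qK h1 h2 hc⟩

end DConcordance

end Summit.ABC.IUTFork.Charitable

end
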